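import Mathlib
import HarnessLib
import HarnessLib.Audit
import Summits.Langlands.Statement
import Summits.Langlands.Langlands.Theses.PrimeSwitchSplit
import Literature.NumberTheory.Automorphic.AutomorphicTwistHecke
import HarnessLib.Audit.Status.Attr

/-!
Route: DeligneSerreSplit

# Route DeligneSerreSplit — the (A)-side core W⁺ of GL(n) reciprocity cut at the Artin range —
motivic-range avatars | residual Artin avatars + conjugate eigensystems + a Deligne–Serre bridge

Decomposition node of the Langlands root ladder (RESIDUAL MODE, cell decomp-langlands, lens-5
«finite/base range + asymptotic regime + bridge», gen 2),
CHILD of route-Langlands-PrimeSwitchSplit (N0) at its (A)-side core W⁺ =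
`PrimeSwitchSplit.SatakeAvatarExistence` (stmt-Langlands-17415, BARRIER leaf in every
cell route) — «refines route-Langlands-PrimeSwitchSplit:SatakeAvatarExistence» (the edge is carried
by this header and, in Lean, by `closes`, which PROVES W⁺ from the
pieces and invokes `PrimeSwitchSplit.closes`, U by the landed `AvatarConjugacy_holds`).
X = M ∧ Z1 ∧ Z2 ∧ DS: cut W⁺ by the ARITHMETIC of the Satake eigenvalues (the typed root cannot see
π_∞): the ARTIN RANGE `InArtinRange π` (cell predicate, inlined;
π is a.e. a Hecke-character twist of an integrally L-arithmetic cuspidal π₀ with |e_n(α_v)| = 1 and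
all e_k(α_v) algebraic integers in ONE number field E) versus its
complement.  M = W⁺ verbatim OFF the range (motivic/asymptotic regime).  ON the range W⁺ is NOT kept
restricted but split by aspect into Z1 = residual (mod-λ) avatars for
every (ℓ, ι), Z2 = every Aut(ℂ)-conjugate eigensystem of π₀ is L-algebraic cuspidal automorphic, and
the support DS = the Deligne–Serre bridge Z1 → Z2 → W⁺|range
(D–S 1974 §§5, 7, 8 run for GL(n)/K with Jacquet–Shalika, Larsen–Pink and Brauer–Nesbitt).  ONE
EQUIV (the range cut, excluded middle; kernel
`satakeAvatarExistence_iff_pieces (hZ2) : W⁺ ↔ M ∧ Z1 ∧ DS`) with the split beneath it; M, Z1, DS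
WEAKER than W⁺ and Z2 WEAKER than Langlands by kernel certificates
(HOME/nodes/lens-5-g2-DeligneSerreSplit.lean: `motivicRangeAvatars_of_W`,
`residualArtinAvatars_of_W`, `deligneSerreBridge_of_W`, `conjugateEigensystems_of_langlands`,
`pieces_of_langlands`); no piece gives W⁺ or Langlands cheaply (probes; BC7 4/4 CLEAN).
WHY THIS IS NOVEL: the first node of the cell that opens the (A)-side core W⁺ = stmt-Langlands-17415
— the BARRIER leaf carried whole by EVERY other cell route (so far cut only existence ∣
irreducibility on RootDecomp1 23598/23601, restricted by HT multiplicity on WeightMultiplicitySplit,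
weakened to W_geo 25718 on TriangularRankLadder) — along the ARITHMETIC of the Satake eigenvalues
(the typed root cannot see π_∞): the twist-saturated ARTIN RANGE (one number field of integral
eigenvalues, unitary e_n) versus its complement; OFF the range W⁺ verbatim (M), ON the range an
ASPECT split (census rule G9) into residual mod-λ avatars Z1 (INSTRUMENTABLE weight-one boxes),
Aut(ℂ)-conjugate eigensystems Z2 and the PRINT-ASSEMBLABLE Deligne–Serre bridge DS : Z1 → Z2 →
W⁺|range for GL(n)/K (Rankin finiteness by Jacquet–Shalika, Larsen–Pink bounded residual images,
two-prime lifting + Brauer–Nesbitt) — Deligne–Serre's 1974 weight-one construction typed as a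
root-level decomposition of W⁺ for every rank and field; ONE EQUIV = the range cut, kernel
`satakeAvatarExistence_iff_pieces (hZ2) : W⁺ ↔ M ∧ Z1 ∧ DS`. LINEAGE: NODE
decomp-langlands-lens-5-g2 04:23:24Z (HOME/STATUS.md L167; nodes/lens-5-g2-DeligneSerreSplit.lean
sha256 6b97855d…, 8 probe batteries FAIL as required, BC7 4/4 CLEAN, kit natively certified
binder_used 8/8), CLEARED by decomp-langlands crit-1 CLEARED 2026-08-30T04:28:38Z (HOME/STATUS.md
L170; HOME/CRITIC-LEDGER.md row 40); filed by the cell's route-writer decomp-langlands-writer-1 (gen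
2) as a CHILD route of route-Langlands-PrimeSwitchSplit = N0 refining :SatakeAvatarExistence 17415
(imports it; `closes` proves W⁺ from the pieces and invokes PrimeSwitchSplit.closes, U by the landed
`AvatarConjugacy_holds`) — TREE policy (ii) (`--refines PrimeSwitchSplit:17415` once gate #12 is
live). BC1 = 6 open cruxes (M, Z1, Z2, B_w 17414, P 17534, L∤R 18084; DS / CRD supports). Census
instrument of record: HOME/census/COSTUME-CENSUS-v5.md sha256
4c4c938f4ba8bead62a8d95c7cee857e9c4443944275227b18353a92e3920031 (json a21ab992…). Rung currency:
rung 0 (first prover target = DS, print-assemblable).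
Lean: MotivicRangeAvatars ∧ ResidualArtinAvatars ∧ ConjugateEigensystems ∧ DeligneSerreBridge
(one-liners over PrimeSwitchSplit / AutomorphicTwistHecke vocabulary).

Rationale: WHY THIS LINE. The only unconditional construction of Galois avatars for NON-regular automorphic
forms that does not pass through étale cohomology of a Shimura variety is Deligne–Serre 1974 (weight
one): mod-λ avatars from congruences with regular (weight ℓ) forms for infinitely many λ, then a
Rankin bound forcing the residual images to have bounded order, then lifting to characteristic zero
and gluing two primes (DeligneSerre1974 §§6–8; Hilbert weight one: RogawskiTunnell1983, Jarvis1997).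
Every cell route so far leaves W⁺ as a BARRIER leaf or restricts it by Hodge–Tate multiplicity; none
separates the two INPUTS that made 1974 work from the BRIDGE between them. This route types the
inputs as separately weaker cruxes on the twist-saturated Artin range — Z1 (residual avatars, the
congruence step) and Z2 (Aut(ℂ)-conjugates of the eigensystem are automorphic, D–S (2.7.4), needed
because Prop. 5.5 bounds ALL conjugates) — and the bridge DS as a print-assemblable support
(Jacquet–Shalika JacquetShalika1981 for Rankin, Larsen–Pink 2011 doi:10.1090/S0894-0347-2011-00695-4
for D–S Prop. 7.2 in GL_n, Brauer–Nesbitt / D–S Lemma 3.2 for the two-prime trick, Brauer1947 for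
irreducibility by pole order); off the range M is W⁺ verbatim, where the motivic engines live
(HarrisLanTaylorThorne2016, Scholze2015, BuzzardGeeLMS2014 Conj. 3.2.1). Imported: analytic number
theory (pair L-function poles) and finite group theory (Larsen–Pink) into the (A) side.
RANKED CRUXES. r2 ResidualArtinAvatars (Z1: hardest-informative — residual avatars on the Artin
range need congruences to regular weight at infinitely many λ; instrumentable in every coherent
weight-one box, idea-needed for Maass/Bianchi type); r3 MotivicRangeAvatars (M: W⁺ off the range,
barrier ShimuraVarietyRealization for general K, attackable regular-algebraic CM/TR sector); r4
ConjugateEigensystems (Z2: Aut(ℂ)-stability of integrally L-arithmetic cuspidal eigensystems;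
attackable coherent sector, barrier NonRegularWeight for Maass type); inherited N0 cruxes r5
WeakGeometricAutomorphy 17414, r6 PadicMemberCompatibility 17534, r7 CompatibilityAwayFromLR 18084;
supports DeligneSerreBridge (DS, r9, first prover target) and CanonicalReciprocityData 17930.
KILL CRITERIA. (i) A cuspidal L-algebraic π₀ satisfying the inlined IsArtinArithmetic clause and a σ
∈ Aut(ℂ) such that the σ-conjugate eigensystem is provably NOT cuspidal automorphic refutes Z2 (and
closes the route: the bridge needs every conjugate); (ii) an integrally L-arithmetic π₀ and (ℓ, ι)
with NO mod-𝔪 avatar refutes Z1 — but Z1 is implied by W⁺ (kernel), so this would refute W⁺ and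
Langlands itself; (iii) DS refuted as typed (e.g. a vacuity artefact of HasSatakeParamAt at the
finitely many bad places) ⇒ misstatement, repair by re-typing the a.e. clauses; (iv) the critic's
orbit-closure test: an L-algebraic cuspidal π ∉ ArtinRange(K) with BC_{L/K}(π) ∈ ArtinRange(L) for
cyclic L/K that makes M or the range cell decorative (none can exist given W⁺: finite image on Γ_L
forces finite image on Γ_K).
NOT DECOMPOSED YET. Z1 by weight-one box (classical / Hilbert parallel / Hilbert partial /
unitary-Shimura coherent LDS / Maass–Bianchi); M by field type and regularity (= RootDecomp1's
23598/23601 and WeightMultiplicitySplit's cells restricted off the range — attach by id in tenure,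
do not re-file); DS into its four print lemmas (Rankin finiteness à la D–S 5.5 for GL_n, Larsen–Pink
bound under condition C(η, M), prime-to-ℓ lifting + two-prime gluing, irreducibility by pole order)
— provers attach these with --supports, they never become items.
CHEAPEST FALSIFIER. `lean check` of HOME/nodes/lens-5-g2-DeligneSerreSplit.lean (done: rc 0, 0
sorry, std axioms): the certificates W⁺ → M, W⁺ → Z1, W⁺ → DS, Langlands → Z2 and the exactness `W⁺
↔ M ∧ Z1 ∧ DS (given Z2)` all kernel-checked, the eight probe batteries fail, BC7 4/4 CLEAN;
mathematically: check Z2 at σ = complex conjugation (π₀^c ≅ π₀^∨ for unitary π₀ — known) and at a CM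
weight-one dihedral form (AI of a finite-order Hecke character: conjugates are AI of the conjugate
character — known), the two cases where a typing slip would show first.

Novelty: Searches (2026-08-30): lit search --hybrid «Deligne Serre lemma generalisation GL(n) finite image
bounded Hecke eigenvalues weight one Galois representation» → [corpus:paper:doi-10-24033-asens-1277]
D–S 1974 itself (pp. 7–8, 13–21 read: (2.7.3)/(2.7.4), Lemma 3.2, Prop 5.5, Thm 6.7, Lemma 6.11,
6.13, Prop 7.2, §8.2–8.7), [corpus:paper:doi-10-1515-crll-1997-491-199 p.20] Jarvis 1997 citing
Rogawski–Tunnell 1983 (Hilbert weight one by the same congruence method),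
[corpus:paper:arxiv-1908.07929 p.18] citing Goldring–Koskivirta 2019 (strata Hasse invariants ⇒
Galois pseudo-representations for coherent LDS), [corpus:paper:arxiv-1009.0785 p.13–14] Buzzard–Gee
Def. 3.1.3 / Conj. 3.1.5–3.1.6 and the Maass algebraicity caveat (Sarnak MR1975448),
[corpus:paper:doi-10-1090-s0894-0347-2011-00695-4] Larsen–Pink 2011; no corpus statement of a GL_n
Deligne–Serre bridge with the conjugate-eigensystem input typed separately. lit galaxy search
"weight one|Deligne-Serre|finite image" --star pdf → 12 rows, none relevant [galaxy: null]. Tree: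
`lean search` found no decl of shape Z1/Z2/DS; RootDecomp1 (existence ∣ irreducibility),
WeightMultiplicitySplit / lens-2-g0 SatakeAvatarWall (HT-multiplicity cells = W⁺ restricted, no
split beneath) and W_geo 25718 are the only cuts of W⁺ in the cell (HOME/nodes grep: «Deligne–Serre»
appears only as an engine mention in lens-2-g0, lens-3, lens-4 memos). Nearest prior art:
Deligne–Serre 1974 §8 (n = 2, K = ℚ, holomorphic weight one) and its Hilbert descendan  [refs: paper:doi-10-24033-asens-1277, paper:doi-10-1515-crll-1997-491-199, paper:arxiv-1908.07929, paper:arxiv-1009.0785, paper:doi-10-1090-s0894-0347-2011-00695-4]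

Barriers (technique_class: residual-avatars; deligne-serre bridge; conj-eigensystems): - technique_class: residual-avatars; deligne-serre bridge; conj-eigensystems
- Literature.Barriers.Langlands.NonRegularWeightBarrier: bites M only for irregular NON-Artin π
(partial weight one type with non-zero HT spread at some place) and bites Z2 for Maass-type
eigensystems (Aut(ℂ)-stability open; the barrier's docstring quotes Scholze 2015 §1 on
algebraicity); Z1 EVADES it where a congruence to regular weight exists (the D–S move: multiply by a
Hasse invariant / Eisenstein series — no Shimura-variety realisation of π₀ itself is needed, only of
its mod-λ eigensystem), and DS is outside its class (group theory + pair L-functions).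
- Literature.Barriers.Langlands.ShimuraVarietyRealizationBarrier: bites M over fields neither
totally real nor CM exactly as it bites W⁺; does not quantify over Z1 (residual eigensystems can be
realised in torsion/coherent cohomology after congruence — Scholze 2015 / Goldring–Koskivirta for
the boxes named) nor over DS.
- Literature.Barriers.Langlands.SolvableImageBarrier: not in this route's class (no
Langlands–Tunnell step; the bridge produces the Artin avatar from the automorphic side, it does not
prove automorphy of an Artin representation).
- Literature.Barriers.Langlands.NonRegularWeightBarrierNarrow: as the non-narrow entry — bites M
(irregular non-Artin π) and Z2 (Maass-type Aut(ℂ)-stability); Z1 evades by congruence to regular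
weight where available; DS outside.
- Literature.Barriers.Langlands.ShimuraVarietyRealizationBarrierNarrow: as th

sub-problem: Langlands · status: draft · opened planner-decomp-langlands-writer-1-g2-0 2026-08-30T04:28:56Z · rev 0 · ledger route-Langlands-DeligneSerreSplit
GENERATED by the gate from the ledger (D-0016/17). Provers cite these decls: `theorem foo : Summit.Langlands.Langlands.Theses.DeligneSerreSplit.<Decl> := …` in Summits/Langlands/Langlands/Theorems/<Name>.lean.
-/

namespace Summit.Langlands.Langlands.Theses.DeligneSerreSplit

open scoped BigOperators Topology Manifold Classical MeasureTheory ProbabilityTheory Matrix InnerProductSpace ComplexConjugate ContinuousMap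
open Filter Set Function TopologicalSpace MeasureTheory

attribute [summit_statement] _root_.Langlands

/-- item stmt-Langlands-27738 · crux · rank 2 · open · by planner
why it might fail: outside coherent weight-one boxes (Maass λ=1/4 Galois type, Bianchi, GL₃ Artin type) no congruence of π₀ to a regular-weight eigensystem mod λ is known for ANY λ, let alone infinitely many; Hasse-invariant tricks need a Shimura variety carrying π₀'s coherent class.
sources: DeligneSerre1974, RogawskiTunnell1983, Jarvis1997, GoldringKoskivirta2019, Scholze2015
[crux] Z1 — RESIDUAL ARTIN AVATARS on the Artin range: for every number field K, n ≥ 1, every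
cuspidal π₀ of GL_n(𝔸_K) that is integrally L-arithmetic with unitary central value (L-algebraic;
one number field E ∋ all e_k(α_v); e_k(α_v) algebraic integers; |e_n(α_v)| = 1, a.e. v) and every
(ℓ, ι): a Galois representation ρ′ : Γ_K → GL_n(ℚ̄_ℓ) whose (ℤ̄_ℓ-integral) Frobenius polynomials
are congruent mod 𝔪 to the ι-Satake polynomials of π₀ at almost every place (the mod-λ shadow of W⁺;
Deligne–Serre Thm 6.7 is the GL₂/ℚ weight-one instance). WEAKER: W⁺ → Z1 kernel-checked.
[difficulty: XL] TAGS (decomp-langlands crit-1 CLEARED 2026-08-30T04:28:38Z (HOME/STATUS.md L170;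
HOME/CRITIC-LEDGER.md row 40); census v5 sha256 4c4c938f…): Z1 NEW · WEAKER (kernel
`residualArtinAvatars_of_W`, nodes/lens-5-g2-DeligneSerreSplit.lean; probes Z1 ⇏ W⁺ / Langlands
FAIL; BC7 CLEAN) · OPEN · INSTRUMENTABLE weight-one boxes (Deligne–Serre Thm 6.7 GL₂/ℚ;
Rogawski–Tunnell / Jarvis 1997 Hilbert weight one; Goldring–Koskivirta coherent strata) · leaf
IDEA-NEEDED Maass / Bianchi / GL₃ Artin-type π₀ · EVADES
`Literature.Barriers.Langlands.NonRegularWeightBarrier_holds` where a congruence to regular weight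
exist -/
@[route_item "route-Langlands-DeligneSerreSplit", crux]
def ResidualArtinAvatars : Prop :=
  ∀ (K : Type) [Field K] [NumberField K] (n : ℕ) (hcpt : Literature.NumberTheory.Automorphic.isCompact_glFiniteIntegralLevel n K), 0 < n → ∀ (π₀ : Literature.NumberTheory.Automorphic.CuspidalAutomorphicRepData n K hcpt), (π₀.1.IsLAlgebraic ∧ ∃ E : IntermediateField ℚ ℂ, FiniteDimensional ℚ E ∧ ∀ᶠ v : IsDedekindDomain.HeightOneSpectrum (NumberField.RingOfIntegers K) in Filter.cofinite, ∀ α : Multiset ℂ, π₀.1.HasSatakeParamAt v α → ‖α.prod‖ = 1 ∧ ∀ k : ℕ, α.esymm k ∈ E ∧ IsIntegral ℤ (α.esymm k)) → ∀ (ℓ : ℕ) [Fact ℓ.Prime] (ι : PadicAlgCl ℓ ≃+* ℂ), ∃ ρ' : Literature.NumberTheory.GaloisRepresentations.FramedGaloisRep K (PadicAlgCl ℓ) n, ∀ᶠ v : IsDedekindDomain.HeightOneSpectrum (NumberField.RingOfIntegers K) in Filter.cofinite, ρ'.IsUnramifiedAt v ∧ (∃ α : Multiset ℂ, π₀.1.HasSatakeParamAt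 v α) ∧ ∀ α : Multiset ℂ, π₀.1.HasSatakeParamAt v α → ∃ P Q : Polynomial (Valued.v : Valuation (PadicAlgCl ℓ) NNReal).valuationSubring, ρ'.HasFrobCharpolyAt v (P.map (Valued.v : Valuation (PadicAlgCl ℓ) NNReal).valuationSubring.subtype) ∧ Literature.NumberTheory.Automorphic.arithFrobPolyOfSatake ι v.residueCard 1 α = Q.map (Valued.v : Valuation (PadicAlgCl ℓ) NNReal).valuationSubring.subtype ∧ P.map (IsLocalRing.residue (Valued.v : Valuation (PadicAlgCl ℓ) NNReal).valuationSubring) = Q.map (IsLocalRing.residue (Valued.v : Valuation (PadicAlgCl ℓ) NNReal).valuationSubring)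

/-- item stmt-Langlands-27739 · crux · rank 3 · open · by planner
why it might fail: no construction of ρ for irregular non-Artin π (partial weight one, non-cohomological) or over K neither totally real nor CM; irreducibility open for n ≥ 3 outside polarizable / density-one cases — exactly W⁺'s failure modes off the Artin range.
sources: BuzzardGeeLMS2014, HarrisLanTaylorThorne2016, Scholze2015, PatrikisTaylor2015
[crux] M — MOTIVIC-RANGE AVATARS: W⁺ (stmt-Langlands-17415) verbatim for every L-algebraic cuspidal
π that is NOT a.e. a Hecke-character twist of an integrally L-arithmetic π₀ with unitary central
value (the complement of the Artin range: every π with non-zero Hodge–Tate spread lives here).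
WEAKER: W⁺ → M kernel-checked; leaf BARRIER(ShimuraVarietyRealization, general K) + ATTACKABLE
regular-algebraic CM/TR sector. [difficulty: open-problem] TAGS (decomp-langlands crit-1 CLEARED
2026-08-30T04:28:38Z (HOME/STATUS.md L170; HOME/CRITIC-LEDGER.md row 40); census v5): M = W⁺
verbatim OFF the Artin range · WEAKER (kernel `motivicRangeAvatars_of_W`; probes M ⇏ W⁺ FAIL; BC7
CLEAN) · OPEN · ATTACKABLE regular-algebraic CM/TR sector (HLTT / Scholze / Shin; tree sector
lang.S27) · leaf BARRIER `Literature.Barriers.Langlands.ShimuraVarietyRealizationBarrier_holds`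
(general K) and `NonRegularWeightBarrier_holds` (irregular non-Artin π: partial weight one with
non-zero HT spread) — carried, not evaded; = the bulk of W⁺. -/
@[route_item "route-Langlands-DeligneSerreSplit", crux]
def MotivicRangeAvatars : Prop :=
  ∀ (K : Type) [Field K] [NumberField K] (n : ℕ) (hcpt : Literature.NumberTheory.Automorphic.isCompact_glFiniteIntegralLevel n K), 0 < n → ∀ (π : Literature.NumberTheory.Automorphic.CuspidalAutomorphicRepData n K hcpt), π.1.IsLAlgebraic → ¬ (∃ (π₀ : Literature.NumberTheory.Automorphic.CuspidalAutomorphicRepData n K hcpt) (χ : Literature.NumberTheory.GaloisRepresentations.HeckeCharacter K), (π₀.1.IsLAlgebraic ∧ ∃ E : IntermediateField ℚ ℂ, FiniteDimensional ℚ E ∧ ∀ᶠ v : IsDedekindDomain.HeightOneSpectrum (NumberField.RingOfIntegers K) in Filter.cofinite, ∀ α : Multiset ℂ, π₀.1.HasSatakeParamAt v α → ‖α.prod‖ = 1 ∧ ∀ k : ℕ, α.esymm k ∈ E ∧ IsIntegral ℤ (α.esymm k)) ∧ ∀ᶠ v : IsDedekindDomain.HeightOneSpectrum (NumberField.RingOfIntegers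 K) in Filter.cofinite, ∀ α₀ : Multiset ℂ, π₀.1.HasSatakeParamAt v α₀ → π.1.HasSatakeParamAt v (α₀.map (χ.valueAtUniformizer v * ·))) → ∀ (ℓ : ℕ) [Fact ℓ.Prime] (ι : PadicAlgCl ℓ ≃+* ℂ), ∃ ρ : Literature.NumberTheory.GaloisRepresentations.FramedGaloisRep K (PadicAlgCl ℓ) n, ρ.toGaloisRep.IsIrreducible ∧ ∀ᶠ v : IsDedekindDomain.HeightOneSpectrum (NumberField.RingOfIntegers K) in Filter.cofinite, SatakeFrobCompatibleAt ι π.1 ρ v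

/-- item stmt-Langlands-27740 · crux · rank 4 · open · by planner
why it might fail: for Maass-type (π_∞ of Galois type, non-cohomological) eigensystems Aut(ℂ)-stability of the cuspidal spectrum is open even for GL₂/ℚ — no rational structure on the relevant cohomology is known (Scholze 2015 §1; Buzzard–Gee §3.1).
sources: DeligneSerre1974, Clozel1990, BuzzardGeeLMS2014, BlasiusHarrisRamakrishnan1994, Scholze2015
[crux] Z2 — CONJUGATE EIGENSYSTEMS: for every integrally L-arithmetic cuspidal π₀ (as in Z1) and
every ring automorphism σ of ℂ there is an L-algebraic cuspidal π′ of GL_n(𝔸_K) whose Satake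
parameters are σ(α_v(π₀)) at almost every place (Deligne–Serre (2.7.4) for weight one; Clozel 1990
Thm 3.13 for regular algebraic; Buzzard–Gee Conj. 3.1.6 in general). WEAKER: Langlands → Z2
kernel-checked via (A) at (2, ι) and (B) at (2, ι∘σ); NOT implied by W⁺ alone. [difficulty:
open-problem] TAGS (decomp-langlands crit-1 CLEARED 2026-08-30T04:28:38Z (HOME/STATUS.md L170;
HOME/CRITIC-LEDGER.md row 40); census v5): Z2 NEW · WEAKER than Langlands via (A)+(B) (kernel
`conjugateEigensystems_of_langlands`), NOT implied by W⁺ alone (probe) · OPEN · ATTACKABLE coherent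
/ regular-algebraic sector (Clozel 1990 Thm 3.13; Deligne–Serre (2.7.4) weight one; Buzzard–Gee
Conj. 3.1.6 in general) · leaf BARRIER `Literature.Barriers.Langlands.NonRegularWeightBarrier_holds`
(Aut(ℂ)-stability of Maass-type eigensystems open — Sarnak) · IDEA-NEEDED there. -/
@[route_item "route-Langlands-DeligneSerreSplit", crux]
def ConjugateEigensystems : Prop :=
  ∀ (K : Type) [Field K] [NumberField K] (n : ℕ) (hcpt : Literature.NumberTheory.Automorphic.isCompact_glFiniteIntegralLevel n K), 0 < n → ∀ (π₀ : Literature.NumberTheory.Automorphic.CuspidalAutomorphicRepData n K hcpt), (π₀.1.IsLAlgebraic ∧ ∃ E : IntermediateField ℚ ℂ, FiniteDimensional ℚ E ∧ ∀ᶠ v : IsDedekindDomain.HeightOneSpectrum (NumberField.RingOfIntegers K) in Filter.cofinite, ∀ α : Multiset ℂ, π₀.1.HasSatakeParamAt v α → ‖α.prod‖ = 1 ∧ ∀ k : ℕ, α.esymm k ∈ E ∧ IsIntegral ℤ (α.esymm k)) → ∀ σ : ℂ ≃+* ℂ, ∃ π' : Literature.NumberTheory.Automorphic.CuspidalAutomorphicRepData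 n K hcpt, π'.1.IsLAlgebraic ∧ ∀ᶠ v : IsDedekindDomain.HeightOneSpectrum (NumberField.RingOfIntegers K) in Filter.cofinite, ∀ α : Multiset ℂ, π₀.1.HasSatakeParamAt v α → π'.1.HasSatakeParamAt v (α.map σ)

/-- item stmt-Langlands-17414 · crux · rank 5 · open
refined by: route-Langlands-HodgeTatePurityCarving [split, open]; route-Langlands-MotivicDictionarySplit [split, open]; route-Langlands-FrobeniusUnitCarving [split, open] · by planner
why it might fail: Automorphy lifting exists only for regular, residually adequate ρ over TR/CM fields and gives POTENTIAL automorphy (BLGGT 4.2.1, ten-author 6.1.1); irregular weights / general K have no engine even for n = 2.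
sources: FontaineMazurGeometric1995, BuzzardGeeLMS2014, ACCGHLNSTT2023, BarnetlambEtAl2014, Kisin2009
[crux] B_w — Fontaine–Mazur–Langlands, almost-everywhere form, for every number field K and n ≥ 1:
every irreducible ρ : Γ_K → GL_n(ℚ̄_ℓ) that is unramified a.e. and de Rham above ℓ (Fontaine's
pinned datum) is Satake–Frobenius compatible at almost all places with some L-algebraic cuspidal π
of GL_n(𝔸_K). Verbatim the statement `weakAutomorphy_of_stubs` of line `Sketch` of crux
stmt-Langlands-14328 (there derived from the Literature text lang.S03). Rec-free. [difficulty: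
open-problem] -/
@[route_item "route-Langlands-DeligneSerreSplit", crux]
def WeakGeometricAutomorphy : Prop :=
  ∀ (K : Type) [Field K] [NumberField K] (n : ℕ) (hcpt : Literature.NumberTheory.Automorphic.isCompact_glFiniteIntegralLevel n K), 0 < n → ∀ (ℓ : ℕ) [Fact ℓ.Prime] (ι : PadicAlgCl ℓ ≃+* ℂ) (ρ : Literature.NumberTheory.GaloisRepresentations.FramedGaloisRep K (PadicAlgCl ℓ) n), ρ.toGaloisRep.IsIrreducible → ((∀ᶠ v : IsDedekindDomain.HeightOneSpectrum (NumberField.RingOfIntegers K) in cofinite, ρ.IsUnramifiedAt v) ∧ ∀ (v : IsDedekindDomain.HeightOneSpectrum (NumberField.RingOfIntegers K)) (hv : ((ℓ : ℕ) : NumberField.RingOfIntegers K) ∈ v.asIdeal), (Literature.NumberTheory.PAdicHodge.fontainePstAdicCompletion v ℓ hv).IsDeRhamFramed (ρ.toLocal v)) → ∃ π : Literature.NumberTheory.Automorphic.CuspidalAutomorphicRepData n K hcpt, π.1.IsLAlgebraic ∧ ∀ᶠ v : IsDedekindDomain.HeightOneSpectrum (NumberField.RingOfIntegers K) in cofinite,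 SatakeFrobCompatibleAt ι π.1 ρ v

/-- item stmt-Langlands-17534 · crux · rank 6 · open · by planner
why it might fail: local–global compatibility at v ∣ ℓ for non-polarizable π over general K is known only up to semisimplification/monodromy in the CM case (ACC+, torsion classes); de Rhamness of ρ_π at ℓ open for irregular π.
sources: ACC2023, Caraiani2014, BarnetlambEtAl2014, arXiv:2109.14145
[crux] P — the PRIME-SWITCH PRINCIPLE for the p-adic member of the automorphic compatible system
(Rec-parametric, Rec-free in content; rev 1, cone repair: stated over the summit's own predicates
only): for π L-algebraic cuspidal on GL_n/K, ρ an irreducible ℓ-adic avatar of (π, ι)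
(Satake–Frobenius compatible a.e.) and a place v ∣ ℓ: (i) ρ|_v is de Rham for Fontaine's pinned
datum; (ii) for EVERY reciprocity datum Rec, every prime ℓ' ∤ v, ι' and every irreducible ℓ'-adic
avatar ρ' of (π, ι'), local–global compatibility of (π, ρ') at v for Rec (read ℓ'-adically,
Grothendieck–Deligne) implies local–global compatibility of (π, ρ) at v for Rec (read through
D_pst). Mathematically (ii) is Fontaine's C_WD for the system {ρ_(π,ι)}: the
Frobenius-semisimplified Weil–Deligne representation at v of the p-adic member, computed by D_pst,
is the common one of the ℓ'-adic members (Saito arXiv:math/0612077 for Hilbert modular forms;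
Caraiani 2012/2014 for Shimura varieties; AHTW 2026 Thm 1.2.1 up to semisimplification for regular π
over CM). Kernel-certified consequence of `Langlands` (bc/SubsOfLanglands.lean); with L∤ at (π, ι',
ρ') it is Taylor's Conj. 7 at v ∣ ℓ — the glue's patching lemma. -/
@[route_item "route-Langlands-DeligneSerreSplit", crux]
def PadicMemberCompatibility : Prop :=
  ∀ (K : Type) [Field K] [NumberField K] (n : ℕ) (hcpt : Literature.NumberTheory.Automorphic.isCompact_glFiniteIntegralLevel n K), 0 < n → ∀ (π : Literature.NumberTheory.Automorphic.CuspidalAutomorphicRepData n K hcpt), π.1.IsLAlgebraic → ∀ (ℓ : ℕ) [Fact ℓ.Prime] (ι : PadicAlgCl ℓ ≃+* ℂ) (ρ : Literature.NumberTheory.GaloisRepresentations.FramedGaloisRep K (PadicAlgCl ℓ) n), ρ.toGaloisRep.IsIrreducible → (∀ᶠ v : IsDedekindDomain.HeightOneSpectrum (NumberField.RingOfIntegers K) in cofinite, SatakeFrobCompatibleAt ι π.1 ρ v) → ∀ (v : IsDedekindDomain.HeightOneSpectrum (NumberField.RingOfIntegers K)) (hv : ((ℓ : ℕ) : NumberField.RingOfIntegers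 K) ∈ v.asIdeal), (Literature.NumberTheory.PAdicHodge.fontainePstAdicCompletion v ℓ hv).IsDeRhamFramed (ρ.toLocal v) ∧ ∀ (Rec : ReciprocityData K) (ℓ' : ℕ) [Fact ℓ'.Prime] (ι' : PadicAlgCl ℓ' ≃+* ℂ) (ρ' : Literature.NumberTheory.GaloisRepresentations.FramedGaloisRep K (PadicAlgCl ℓ') n), ((ℓ' : ℕ) : NumberField.RingOfIntegers K) ∉ v.asIdeal → ρ'.toGaloisRep.IsIrreducible → (∀ᶠ w : IsDedekindDomain.HeightOneSpectrum (NumberField.RingOfIntegers K) in cofinite, SatakeFrobCompatibleAt ι' π.1 ρ' w) → LocalGlobalCompatibleAt Rec ι' π.1 ρ' v → LocalGlobalCompatibleAt Rec ι π.1 ρ v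

/-- item stmt-Langlands-18084 · crux · rank 7 · open · by planner
why it might fail: away from ℓ the monodromy operator N is not known to match for non-polarizable π over CM K (compatibility up to Frobenius-semisimplification and N only in print), and nothing is known for K neither TR nor CM.
sources: ACC2023, Varma2024, TaylorYoshida2007, arXiv:2109.14145
[crux] L∤R — Taylor 2004 Conj. 7 at the places v ∤ ℓ, in the `∀ Rec` form (rev 4, lockstep re-type
after the summit re-type p141787 `∀ F, Nonempty (ReciprocityData F) ∧ ∀ 𝓡 …`): for every number
field K and EVERY reciprocity datum Rec (Henniart-normalised local Langlands data with THE canonical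
Artin pins — the summit's `∀ 𝓡`), every n ≥ 1 and hcpt, every L-algebraic cuspidal π of GL_n(𝔸_K),
every (ℓ, ι) and every IRREDUCIBLE ρ : Γ_K → GL_n(ℚ̄_ℓ) that is pinned-geometric (unramified a.e.,
de Rham above ℓ for Fontaine's pinned datum) and Satake–Frobenius compatible with (π, ι) a.e.:
`LocalGlobalCompatibleAt Rec ι π ρ v` at every finite v ∤ ℓ (Grothendieck–Deligne Weil–Deligne
representation, Frobenius-semisimplified, ↔ rec_v(π_v)). = item L∤ (stmt-Langlands-17417, ∃-Rec
form; verbatim the registered stub `stub_pairCompatibilityAway` of line `Sketch` of crux 14328) with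
Rec moved from `∃ Rec,` to a universal binder after K and nothing else changed; the ∃-form is
implied back by L∤R ∧ CanonicalReciprocityData (`compatibilityAwayFromL_existsForm`).
Kernel-certified consequence of the re-typed summit (`compatibilityAwayFromLR_of_langlands`, planner
bc/SubsOfLanglandsR.lean: direction (A -/
@[route_item "route-Langlands-DeligneSerreSplit", crux]
def CompatibilityAwayFromLR : Prop :=
  ∀ (K : Type) [Field K] [NumberField K] (Rec : ReciprocityData K) (n : ℕ) (hcpt : Literature.NumberTheory.Automorphic.isCompact_glFiniteIntegralLevel n K), 0 < n → ∀ (π : Literature.NumberTheory.Automorphic.CuspidalAutomorphicRepData n K hcpt), π.1.IsLAlgebraic → ∀ (ℓ : ℕ) [Fact ℓ.Prime] (ι : PadicAlgCl ℓ ≃+* ℂ) (ρ : Literature.NumberTheory.GaloisRepresentations.FramedGaloisRep K (PadicAlgCl ℓ) n), ρ.toGaloisRep.IsIrreducible → ((∀ᶠ v : IsDedekindDomain.HeightOneSpectrum (NumberField.RingOfIntegers K) in cofinite, ρ.IsUnramifiedAt v) ∧ ∀ (v : IsDedekindDomain.HeightOneSpectrum (NumberField.RingOfIntegers K)) (hv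 : ((ℓ : ℕ) : NumberField.RingOfIntegers K) ∈ v.asIdeal), (Literature.NumberTheory.PAdicHodge.fontainePstAdicCompletion v ℓ hv).IsDeRhamFramed (ρ.toLocal v)) → (∀ᶠ v : IsDedekindDomain.HeightOneSpectrum (NumberField.RingOfIntegers K) in cofinite, SatakeFrobCompatibleAt ι π.1 ρ v) → ∀ v : IsDedekindDomain.HeightOneSpectrum (NumberField.RingOfIntegers K), ((ℓ : ℕ) : NumberField.RingOfIntegers K) ∉ v.asIdeal → LocalGlobalCompatibleAt Rec ι π.1 ρ v

/-- item stmt-Langlands-17930 · support · rank 9 · open · by planner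
sources: HarrisTaylor2001
[support] THE SUMMIT'S NON-VACUITY CONJUNCT, verbatim (statement revision p141787, 2026-08-17:
`Langlands := ∀ F, Nonempty (ReciprocityData F) ∧ ∀ 𝓡 n, 0 < n → ∀ hcpt, GLC n F 𝓡 hcpt`, with
`ReciprocityData` pinned to THE local Artin maps by `llc_isCanonical` / `llc_eps_isCanonical`),
filed by route-repair 5a1bd9af as the explicit INPUT of this route's `∃ RD`-shaped slices
(LiftB2Unram, LiftB2UnramSmallF, LiftB2UnramLargeF, LiftB2UnramSplitP): for every number field F and
every finite place v, a local Langlands datum for GL_n(F_v) (Harris–Taylor 2001 Thm A; Henniart 2000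
Thm 1.2) normalised against THE local Artin map `canonicalArtin (F_v)`, whose ε-system (Deligne 1973
Thm 4.1) is normalised against the canonical Artin map of every finite E/F_v. IN PRINT,
textbook-grade input (Harris–Taylor's Thm A is stated relative to Art_K of local class field
theory); in the TREE not yet derivable — `LocalLanglandsDatum.nonempty` (cite-only) yields a datum
with SOME lawful Artin normalisation, and canonicity needs `IsLocalArtinMap.unique` + the
finite-level reciprocity law for that datum's Artin maps, or canonical variants of
`localLanglands_gl` / `nonempty_localEpsilonSystem` (needs-fact for -/
@[route_item "route-Langlands-DeligneSerreSplit", crux]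
def CanonicalReciprocityData : Prop :=
  ∀ (F : Type) [Field F] [NumberField F], Nonempty (Summit.Langlands.ReciprocityData F)

/-- item stmt-Langlands-27741 · support · rank 9 · open · by planner
why it might fail: the GL_n version of D–S Prop 7.2 needs Larsen–Pink with uniformity in ℓ under condition C(η, M); the a.e.-place bookkeeping of HasSatakeParamAt / HeckeCharacter.valueAtUniformizer at the finitely many bad places must match the typed clauses.
sources: DeligneSerre1974, JacquetShalika1981, doi:10.1090/S0894-0347-2011-00695-4, Brauer1947
[support] DS — THE DELIGNE–SERRE BRIDGE for GL(n)/K: ResidualArtinAvatars → ConjugateEigensystems →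
W⁺ on the Artin range. Print-assemblable: Rankin finiteness for π₀ and all its (finitely many, E
fixed) conjugate eigensystems via the pole of the partial pair L-function (Jacquet–Shalika; D–S Prop
5.5) ⇒ residual images satisfy condition C(η, M) (Chebotarev, D–S 8.3) ⇒ bounded order uniformly in
λ (Larsen–Pink 2011 in place of D–S Prop 7.2) ⇒ prime-to-ℓ lift to characteristic 0 at two primes +
Brauer–Nesbitt (D–S 8.6, Lemma 3.2) ⇒ one Artin representation with the right Frobenius polynomials
a.e., irreducible by the pole order (D–S 8.7), transported to every (ℓ, ι) and re-twisted by Weil's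
ℓ-adic avatar of the Hecke character. WEAKER: W⁺ → DS trivially. First prover target. [difficulty:
L] TAGS (decomp-langlands crit-1 CLEARED 2026-08-30T04:28:38Z (HOME/STATUS.md L170;
HOME/CRITIC-LEDGER.md row 40)): DS = support := Z1 → Z2 → W⁺|range · WEAKER (kernel
`deligneSerreBridge_of_W`) · PRINT-ASSEMBLABLE / ATTACKABLE NOW = first prover target: Rankin
finiteness via the pole of the partial pair L-function
(`JacquetShalika1981_partialPairL_pole_repData`; D–S Prop 5.5) ⇒ condition C(η,M) (Che -/
@[route_item "route-Langlands-DeligneSerreSplit", crux]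
def DeligneSerreBridge : Prop :=
  ResidualArtinAvatars → ConjugateEigensystems → ∀ (K : Type) [Field K] [NumberField K] (n : ℕ) (hcpt : Literature.NumberTheory.Automorphic.isCompact_glFiniteIntegralLevel n K), 0 < n → ∀ (π : Literature.NumberTheory.Automorphic.CuspidalAutomorphicRepData n K hcpt), π.1.IsLAlgebraic → (∃ (π₀ : Literature.NumberTheory.Automorphic.CuspidalAutomorphicRepData n K hcpt) (χ : Literature.NumberTheory.GaloisRepresentations.HeckeCharacter K), (π₀.1.IsLAlgebraic ∧ ∃ E : IntermediateField ℚ ℂ, FiniteDimensional ℚ E ∧ ∀ᶠ v : IsDedekindDomain.HeightOneSpectrum (NumberField.RingOfIntegers K) in Filter.cofinite, ∀ α : Multiset ℂ, π₀.1.HasSatakeParamAt v α → ‖α.prod‖ = 1 ∧ ∀ k : ℕ, α.esymm k ∈ E ∧ IsIntegral ℤ (α.esymm k)) ∧ ∀ᶠ v : IsDedekindDomain.HeightOneSpectrum (NumberField.RingOfIntegers K) in Filter.cofinite, ∀ α₀ : Multiset ℂ, π₀.1.HasSatakeParamAt v α₀ → π.1.HasSatakeParamAt v (α₀.map (χ.valueAtUniformizer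 v * ·))) → ∀ (ℓ : ℕ) [Fact ℓ.Prime] (ι : PadicAlgCl ℓ ≃+* ℂ), ∃ ρ : Literature.NumberTheory.GaloisRepresentations.FramedGaloisRep K (PadicAlgCl ℓ) n, ρ.toGaloisRep.IsIrreducible ∧ ∀ᶠ v : IsDedekindDomain.HeightOneSpectrum (NumberField.RingOfIntegers K) in Filter.cofinite, SatakeFrobCompatibleAt ι π.1 ρ v

/-- item stmt-Langlands-27742 · assembly · rank 1 · closed · proved by Summit.Langlands.Langlands.Theorems.deligneSerreSplit_assembly_proof (prover) · by planner
[assembly] M → Z1 → Z2 → DS → B_w → P → L∤R → CRD → Langlands (the deciding theorem `closes` in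
glue.lean proves exactly this through PrimeSwitchSplit.closes, U by AvatarConjugacy_holds). -/
@[route_item "route-Langlands-DeligneSerreSplit"]
def Assembly : Prop :=
  MotivicRangeAvatars → ResidualArtinAvatars → ConjugateEigensystems → DeligneSerreBridge → WeakGeometricAutomorphy → PadicMemberCompatibility → CompatibilityAwayFromLR → CanonicalReciprocityData → _root_.Langlands

-- `Assembly` holds: proved by `Summit.Langlands.Langlands.Theorems.deligneSerreSplit_assembly_proof` (its module imports this route file, so no `_holds` link can be stated here).

/-! D-0027 §2.1 — DECIDING THEOREM (planner-authored via `route open/edit --closes-file`; by planner-decomp-langlands-writer-1-g2-0 2026-08-30T04:28:56Z):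
its hypotheses are this route's items and its conclusion the sub-problem Statement (glue_lint), and it elaborates with this file. -/

@[closes "route-Langlands-DeligneSerreSplit"] theorem closes (hM : MotivicRangeAvatars) (hZ1 : ResidualArtinAvatars) (hZ2 : ConjugateEigensystems)
    (hDS : DeligneSerreBridge) (hB : WeakGeometricAutomorphy) (hP : PadicMemberCompatibility)
    (hA : CompatibilityAwayFromLR) (hR : CanonicalReciprocityData) : _root_.Langlands :=
  PrimeSwitchSplit.closes hB
    (fun K _ _ n hcpt hn π hπ ℓ _ ι =>
      (Classical.em _).elim (fun h => hDS hZ1 hZ2 K n hcpt hn π hπ h ℓ ι) (fun h => hM K n hcpt hn π hπ h ℓ ι))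
    hP hA hR PrimeSwitchSplit.AvatarConjugacy_holds

end Summit.Langlands.Langlands.Theses.DeligneSerreSplit
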